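import Literature.NumberTheory.LFunctions.Equivalents
import Literature.NumberTheory.LFunctions.DeBruijnNewmanFacts
import Literature.NumberTheory.LFunctions.DeBruijnNewmanProofs
import Literature.NumberTheory.LFunctions.DeBruijnStrip
import Literature.NumberTheory.LFunctions.RiemannXiProofs
import Literature.NumberTheory.LFunctions.JensenHermite
import Literature.NumberTheory.LFunctions.JensenAsymptotics
import Literature.NumberTheory.LFunctions.XiMoments
import Literature.Analysis.Complex.Hurwitz
import HarnessLib

/-!
# Newman's characterisation `H_t has only real zeros ↔ Λ ≤ t`: reduction to four inputs

Trunk T-ANT, `Literature/NumberTheory/LFunctions`; companion ("Proofs") file of `Equivalents.lean`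
for the named fact `Literature.NumberTheory.LFunctions.hasOnlyRealZeros_deBruijnH_iff_deBruijnNewmanConst_le`
(C. M. Newman, *Fourier transforms with only real zeros*, Proc. AMS 61 (1976), **Thm. 3**: "there
exists a real number `b₀` with `−1/8 ≤ b₀ < ∞` such that `Ξ_b` has only real zeros when `b ≤ b₀`
but has nonreal zeros when `b > b₀`"; in the de Bruijn / Rodgers–Tao time `t` (Newman's `b` is a
negative multiple of `t`) this says `{t | H_t has only real zeros} = [Λ, ∞)`).

## Contents

Write `S = {t : ℝ | HasOnlyRealZeros (deBruijnH t)}` and `Λ = sInf S = deBruijnNewmanConst`.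

* `hasOnlyRealZeros_deBruijnH_iff_deBruijnNewmanConst_le_iff`: the fact is *equivalent* to the
  conjunction of four properties of `S`: bounded below (Newman 1976, Thm. 3 proper:
  `Literature.NumberTheory.LFunctions.bddBelow_setOf_hasOnlyRealZeros`), nonempty (de Bruijn 1950:
  `Literature.NumberTheory.LFunctions.hasOnlyRealZeros_deBruijnH_one_half`), upward closed (de Bruijn's monotonicity:
  `Literature.NumberTheory.LFunctions.HasOnlyRealZeros.mono_deBruijnH`) and topologically closed (a **theorem** here,
  `isClosed_setOf_hasOnlyRealZeros_deBruijnH`). So the decomposition loses nothing.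
* `hasOnlyRealZeros_deBruijnH_iff_deBruijnNewmanConst_le_of`: the assembly from the four inputs.
* `Literature.NumberTheory.LFunctions.HasOnlyRealZeros.isClosed_setOf`: for any family `H : X → ℂ → ℂ` of entire functions,
  jointly continuous in `(t, z)` and with no member identically zero, `{t | H t has only real zeros}`
  is closed — via Hurwitz's theorem (`Complex.hurwitz_eqOn_zero_or_forall_ne_zero`): if `t' → t`
  with `H t'` zero-free off the real axis, then `H t` is zero-free on every disc avoiding the real
  axis. (With the general-topology lemma `Literature.NumberTheory.LFunctions.tendstoLocallyUniformlyOn_of_continuous_uncurry`: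
  a jointly continuous family converges locally uniformly to each member.)
* `isClosed_setOf_hasOnlyRealZeros_deBruijnH`: `S` is closed — the three analytic inputs are the
  theorems `differentiable_deBruijnH_holds`, `continuous_deBruijnH_uncurry`,
  `exists_deBruijnH_ne_zero` of `DeBruijnNewmanProofs.lean`.
* `hasOnlyRealZeros_deBruijnH_iff_deBruijnNewmanConst_le_of_bddBelow_of_mono`: hence Newman's
  characterisation follows from the three remaining named facts of `DeBruijnNewman.lean` alone:
  `bddBelow_setOf_hasOnlyRealZeros` (Newman 1976, Thm. 3 proper: `Λ > −∞`),
  `hasOnlyRealZeros_deBruijnH_one_half` and `HasOnlyRealZeros.mono_deBruijnH` (de Bruijn 1950,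
  Thm. 13). These are deep (Newman's needs his Thm. 2, a Hadamard-factorisation classification;
  de Bruijn's is his strip theorem) and remain named facts.
* Reduction of those three inputs to the printed theorems: `exists_not_hasOnlyRealZeros_deBruijnH`
  (NAMED FACT, Newman 1976, Thm. 3, "`Ξ_b` has nonreal zeros when `b > b₀`", `b₀ < ∞`) gives
  `bddBelow_setOf_hasOnlyRealZeros` under monotonicity (and conversely);
  `Literature.NumberTheory.LFunctions.de_bruijn_strip` (de Bruijn 1950, Thm. 13, `DeBruijnStrip.lean`) gives monotonicity, and
  together with `Literature.NumberTheory.LFunctions.deBruijnH_zero_eq` (`H_0 = ξ(½ + iz/2)/8`, Titchmarsh §10.1) and the critical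
  strip for `ξ` (`Literature.NumberTheory.LFunctions.riemannXi_eq_zero_iff_holds`, proved) it gives `Λ ≤ 1/2`. Net result:
  `hasOnlyRealZeros_deBruijnH_iff_deBruijnNewmanConst_le_of_newman_of_strip` — Newman's
  characterisation from exactly three named facts, `exists_not_hasOnlyRealZeros_deBruijnH`
  (Newman Thm. 3), `de_bruijn_strip` (de Bruijn Thm. 13), `deBruijnH_zero_eq` (Titchmarsh §10.1).
* Service to the route `RiemannHypothesis/DBN` (whose assembly only needs the endpoint `t = 0`):
  `hasOnlyRealZeros_deBruijnH_zero_of_forall_pos` — if `H_t` has only real zeros for all `t > 0`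
  then so does `H_0` — is now unconditional (closedness alone), and the named facts
  `Literature.NumberTheory.LFunctions.riemannHypothesis_iff_hasOnlyRealZeros_deBruijnH_zero`,
  `Literature.NumberTheory.LFunctions.riemannHypothesis_of_hasOnlyRealZeros_deBruijnH` follow from the single named fact
  `Literature.NumberTheory.LFunctions.deBruijnH_zero_eq` (`H_0 = ξ(½ + iz/2)/8`).
* **rh.S39**, `Literature.NumberTheory.LFunctions.gorz_eventually_holds` — GORZ Thm. 1 (`Literature.NumberTheory.LFunctions.gorz_eventually`: for
  `d ≥ 1` the Jensen polynomials `J^{d,n}_γ` of the Taylor coefficients `γ(n)` of `Ξ` are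
  hyperbolic for all large `n`) **unconditionally**. The printed proof (§5.1) rests on
  positivity `γ(n) > 0` (§1) and the expansion (15) of `log(γ(n+j)/γ(n))` (from the saddle-point
  Thm. 7), fed into Thm. 3 and its Corollary. All four ingredients are proved in the tree:
  Thm. 3, Thm. 6 and the Corollary in `JensenHermite.lean`
  (`Literature.NumberTheory.LFunctions.jensenPoly_xiTaylorCoeff_eventually_splits`), positivity in `XiMoments.lean`
  (`Literature.NumberTheory.LFunctions.xiTaylorCoeff_pos_holds`, from `γ(n) = 64·4ⁿ n!/(2n)! ∫₀^∞ Φ(u) u^{2n} du`), and (15) in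
  `JensenAsymptotics.lean` (`Literature.NumberTheory.LFunctions.xiTaylorCoeff_logRatio_holds`, from the concentration of the
  measures `Φ(u) uᵏ du`, `XiKernelLaplace.lean` / `XiMomentConcentration.lean`, in place of
  Thm. 7). `gorz_eventually_of_logRatio` records the reduction to the two named facts.

## References

* C. M. Newman, *Fourier transforms with only real zeros*, Proc. AMS 61 (1976), 245–251, Thm. 3.
* N. G. de Bruijn, *The roots of trigonometric integrals*, Duke Math. J. 17 (1950), 197–226, Thm. 13.
* B. Rodgers, T. Tao, *The de Bruijn–Newman constant is non-negative*, Forum Math. Pi 8 (2020),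
  §1 ("`H_t` has purely real zeroes if and only if `t ≥ Λ`").
* J. B. Conway, *Functions of one complex variable I*, 2nd ed. (1978), Ch. VII, Thm. 2.5, Cor. 2.6
  (Hurwitz).
* M. Griffin, K. Ono, L. Rolen, D. Zagier, *Jensen polynomials for the Riemann zeta function and
  other sequences*, PNAS 116 (2019) 11103–11110 (arXiv:1902.07321), Thm. 1, Thm. 3, Corollary,
  Thm. 7, §5.1. [GORZPNAS2019]
-/

noncomputable section

open Complex Filter Metric Set Topology

namespace Literature.NumberTheory.LFunctions

/-! ## Closedness of `{t | H t has only real zeros}` for a continuous family of entire functions -/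

/-- A jointly continuous family `(t, x) ↦ H t x` on a locally compact space converges locally
uniformly (i.e. uniformly on compact sets) to `H t₀` as `t → t₀`. General topology; Mathlib has the
compact-domain versions `ContinuousOn.tendstoUniformly` / `Continuous.tendstoUniformly` only.
[folklore] -/
theorem tendstoLocallyUniformlyOn_of_continuous_uncurry {X α E : Type*} [TopologicalSpace X]
    [TopologicalSpace α] [LocallyCompactSpace α] [UniformSpace E] {H : X → α → E}
    (hcont : Continuous (Function.uncurry H)) (t₀ : X) {U : Set α} (hU : IsOpen U) :
    TendstoLocallyUniformlyOn H (H t₀) (𝓝 t₀) U := by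
  refine (tendstoLocallyUniformlyOn_iff_forall_isCompact hU).2 fun K _ hK u hu ↦ ?_
  obtain ⟨u', hu', hsymm, hsub⟩ := symm_of_uniformity hu
  obtain ⟨v, hv, hvK⟩ := hK.mem_uniformity_of_prod hcont.continuousOn (mem_univ t₀) hu'
  rw [nhdsWithin_univ] at hv
  filter_upwards [hv] with t ht x hx
  exact hsub (SetRel.symm u' (hvK t ht x hx))

/-- **Closedness via Hurwitz.** Let `H : X → ℂ → ℂ` be a family of entire functions, jointly
continuous in `(t, z)`, none of which vanishes identically. Then `{t | H t has only real zeros}` is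
closed in `X`: for `t` in its closure and a zero `z` of `H t` off the real axis, Hurwitz's theorem
on the disc `ball z |Im z|` (which avoids `ℝ`, so every nearby `H t'` with only real zeros is
zero-free there) forces `H t ≡ 0` on the disc, hence on `ℂ`. [cite: Conway1978, Ch. VII Cor. 2.6] -/
theorem HasOnlyRealZeros.isClosed_setOf {X : Type*} [TopologicalSpace X] {H : X → ℂ → ℂ}
    (hdiff : ∀ t, Differentiable ℂ (H t)) (hcont : Continuous (Function.uncurry H))
    (hne : ∀ t, ∃ z, H t z ≠ 0) : IsClosed {t : X | HasOnlyRealZeros (H t)} := by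
  refine isClosed_iff_frequently.2 fun t ht z hz ↦ ?_
  by_contra him
  set r : ℝ := |z.im| with hr
  have hrpos : 0 < r := abs_pos.2 him
  -- the disc `ball z r` avoids the real axis
  have hball : ∀ w ∈ ball z r, w.im ≠ 0 := by
    intro w hw h0
    have h1 : |z.im - w.im| < r := by
      have := abs_im_le_norm (z - w)
      rw [sub_im] at this
      rw [mem_ball, dist_comm, dist_eq_norm] at hw
      exact this.trans_lt hw
    rw [h0, sub_zero] at h1
    exact lt_irrefl _ h1
  have hF : ∀ᶠ t' in 𝓝 t, DifferentiableOn ℂ (H t') (ball z r) :=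
    Eventually.of_forall fun t' ↦ (hdiff t').differentiableOn
  have hlim : TendstoLocallyUniformlyOn H (H t) (𝓝 t) (ball z r) :=
    tendstoLocallyUniformlyOn_of_continuous_uncurry hcont t isOpen_ball
  have h0 : ∃ᶠ t' in 𝓝 t, ∀ w ∈ ball z r, H t' w ≠ 0 :=
    ht.mono fun t' ht' w hw h ↦ hball w hw (ht' w h)
  rcases Complex.hurwitz_eqOn_zero_or_forall_ne_zero isOpen_ball (convex_ball z r).isPreconnected
    hF hlim h0 with h | h
  · -- `H t ≡ 0` on the disc, hence everywhere: contradiction with `hne`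
    obtain ⟨w, hw⟩ := hne t
    have han : AnalyticOnNhd ℂ (H t) univ :=
      (hdiff t).differentiableOn.analyticOnNhd isOpen_univ
    have hev : H t =ᶠ[𝓝 z] 0 := h.eventuallyEq_of_mem (ball_mem_nhds z hrpos)
    have := han.eqOn_zero_of_preconnected_of_eventuallyEq_zero isPreconnected_univ (mem_univ z) hev
    exact hw (this (mem_univ w))
  · exact h z (mem_ball_self hrpos) hz

end Literature.NumberTheory.LFunctions

namespace Literature.NumberTheory.LFunctions

/-! ## Newman's characterisation and the four properties of `{t | H_t has only real zeros}` -/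

/-- Newman's characterisation `∀ t, (H_t has only real zeros ↔ Λ ≤ t)` holds if and only if the
set `S = {t | H_t has only real zeros}` is bounded below, nonempty, upward closed and closed
(then `S = [sInf S, ∞)`; conversely the characterisation says `S = [Λ, ∞)`). [folklore] -/
theorem hasOnlyRealZeros_deBruijnH_iff_deBruijnNewmanConst_le_iff :
    hasOnlyRealZeros_deBruijnH_iff_deBruijnNewmanConst_le ↔
      BddBelow {t : ℝ | HasOnlyRealZeros (deBruijnH t)} ∧
      {t : ℝ | HasOnlyRealZeros (deBruijnH t)}.Nonempty ∧
      (∀ t t' : ℝ, t ≤ t' → HasOnlyRealZeros (deBruijnH t) → HasOnlyRealZeros (deBruijnH t')) ∧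
      IsClosed {t : ℝ | HasOnlyRealZeros (deBruijnH t)} := by
  constructor
  · intro h
    have hS : {t : ℝ | HasOnlyRealZeros (deBruijnH t)} = Ici deBruijnNewmanConst :=
      Set.ext fun t ↦ h t
    refine ⟨?_, ?_, ?_, ?_⟩
    · rw [hS]; exact bddBelow_Ici
    · rw [hS]; exact nonempty_Ici
    · intro t t' htt' ht
      exact (h t').2 (((h t).1 ht).trans htt')
    · rw [hS]; exact isClosed_Ici
  · rintro ⟨hbdd, hne, hmono, hclosed⟩ t
    constructor
    · exact fun ht ↦ csInf_le hbdd ht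
    · intro ht
      exact hmono _ _ ht (hclosed.csInf_mem hne hbdd)

/-- **Assembly** of Newman's characterisation (Newman 1976, Thm. 3) from the four named facts:
`Λ > −∞` (`bddBelow_setOf_hasOnlyRealZeros`, Newman), `H_{1/2}` has only real zeros
(`hasOnlyRealZeros_deBruijnH_one_half`, de Bruijn), de Bruijn's monotonicity
(`HasOnlyRealZeros.mono_deBruijnH`) and closedness of `{t | H_t has only real zeros}` (proved
below: `isClosed_setOf_hasOnlyRealZeros_deBruijnH`). Direction `→` is `csInf_le`; direction `←` is `Λ ∈ S` (closedness) plus monotonicity. [cite: NewmanPAMS1976, Thm. 3] -/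
theorem hasOnlyRealZeros_deBruijnH_iff_deBruijnNewmanConst_le_of
    (hbdd : bddBelow_setOf_hasOnlyRealZeros) (hne : hasOnlyRealZeros_deBruijnH_one_half)
    (hmono : HasOnlyRealZeros.mono_deBruijnH)
    (hclosed : IsClosed {t : ℝ | HasOnlyRealZeros (deBruijnH t)}) :
    hasOnlyRealZeros_deBruijnH_iff_deBruijnNewmanConst_le :=
  hasOnlyRealZeros_deBruijnH_iff_deBruijnNewmanConst_le_iff.2
    ⟨hbdd, ⟨1 / 2, hne⟩, fun _ _ h ht ↦ hmono h ht, hclosed⟩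

/-- Conversely, Newman's characterisation contains Newman's lower bound `Λ > −∞`
(`bddBelow_setOf_hasOnlyRealZeros`). [folklore] -/
theorem bddBelow_setOf_hasOnlyRealZeros_of
    (h : hasOnlyRealZeros_deBruijnH_iff_deBruijnNewmanConst_le) :
    bddBelow_setOf_hasOnlyRealZeros :=
  (hasOnlyRealZeros_deBruijnH_iff_deBruijnNewmanConst_le_iff.1 h).1

/-- **Closedness** (the endpoint case of Newman, Proc. AMS 61 (1976), Thm. 3: `Ξ_b` has only real
zeros "when `b ≤ b₀`", endpoint included; cf. Rodgers–Tao 2020, §1). The set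
`{t | H_t has only real zeros}` is closed in `ℝ` — proved here by Hurwitz's theorem
(`HasOnlyRealZeros.isClosed_setOf`) from the analytic inputs of `DeBruijnNewmanProofs.lean`: each
`H_t` is entire (`differentiable_deBruijnH_holds`), `(t, z) ↦ H_t(z)` is jointly continuous
(`continuous_deBruijnH_uncurry`) and `H_t(0) ≠ 0` (`exists_deBruijnH_ne_zero`). [cite: NewmanPAMS1976, Thm. 3] -/
theorem isClosed_setOf_hasOnlyRealZeros_deBruijnH :
    IsClosed {t : ℝ | HasOnlyRealZeros (deBruijnH t)} :=
  HasOnlyRealZeros.isClosed_setOf differentiable_deBruijnH_holds continuous_deBruijnH_uncurry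
    exists_deBruijnH_ne_zero

/-- Conversely, Newman's characterisation contains the closedness of `{t | H_t has only real zeros}`
(so the four-property decomposition loses nothing). [folklore] -/
theorem isClosed_setOf_hasOnlyRealZeros_deBruijnH_of_characterisation
    (h : hasOnlyRealZeros_deBruijnH_iff_deBruijnNewmanConst_le) :
    IsClosed {t : ℝ | HasOnlyRealZeros (deBruijnH t)} :=
  (hasOnlyRealZeros_deBruijnH_iff_deBruijnNewmanConst_le_iff.1 h).2.2.2

/-- Newman's characterisation `H_t has only real zeros ↔ Λ ≤ t` from the three remaining named
facts: Newman's `Λ > −∞` (`bddBelow_setOf_hasOnlyRealZeros`), de Bruijn's `Λ ≤ 1/2`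
(`hasOnlyRealZeros_deBruijnH_one_half`) and de Bruijn's monotonicity
(`HasOnlyRealZeros.mono_deBruijnH`); closedness is now proved. [cite: NewmanPAMS1976, Thm. 3] -/
theorem hasOnlyRealZeros_deBruijnH_iff_deBruijnNewmanConst_le_of_bddBelow_of_mono
    (hbdd : bddBelow_setOf_hasOnlyRealZeros) (hne : hasOnlyRealZeros_deBruijnH_one_half)
    (hmono : HasOnlyRealZeros.mono_deBruijnH) :
    hasOnlyRealZeros_deBruijnH_iff_deBruijnNewmanConst_le :=
  hasOnlyRealZeros_deBruijnH_iff_deBruijnNewmanConst_le_of hbdd hne hmono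
    isClosed_setOf_hasOnlyRealZeros_deBruijnH

/-- The same with a bare nonemptiness hypothesis in place of de Bruijn's `Λ ≤ 1/2`. [folklore] -/
theorem hasOnlyRealZeros_deBruijnH_iff_deBruijnNewmanConst_le_of_nonempty
    (hbdd : bddBelow_setOf_hasOnlyRealZeros)
    (hne : ∃ t₀ : ℝ, HasOnlyRealZeros (deBruijnH t₀))
    (hmono : HasOnlyRealZeros.mono_deBruijnH) :
    hasOnlyRealZeros_deBruijnH_iff_deBruijnNewmanConst_le :=
  hasOnlyRealZeros_deBruijnH_iff_deBruijnNewmanConst_le_iff.2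
    ⟨hbdd, hne, fun _ _ h ht ↦ hmono h ht, isClosed_setOf_hasOnlyRealZeros_deBruijnH⟩

/-! ## Reduction of the remaining inputs to the printed theorems -/

/-- NAMED FACT (Newman, Proc. AMS 61 (1976), Thm. 3, second half: "`Ξ_b` has nonreal zeros when
`b > b₀`", with `b₀ < ∞`; in de Bruijn's time parameter: some `H_t` has a non-real zero, i.e.
`Λ > −∞`). This is the genuinely new content of Newman's paper (proved there from his Thm. 2, the
classification of even measures all of whose Gaussian tilts have Fourier transforms with only real
zeros, by checking that `Φ` is not of the form (1.8)). **Not** to be confused with the refutation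
thesis `DbnNegativeLambdaPos` of route `RiemannHypothesis/DBN`
(`Summits/RiemannHypothesis/RiemannHypothesis/Theses/DBN.lean`), which is the same sentence *with* `0 < t` (`Λ > 0`, equivalent to `¬ RH`): the present fact carries no sign
information (Newman: `−1/8 ≤ b₀`, i.e. only `Λ > −∞`). Users take
`(h : exists_not_hasOnlyRealZeros_deBruijnH)`. [cite: NewmanPAMS1976, Thm. 3] -/
def exists_not_hasOnlyRealZeros_deBruijnH : Prop :=
  ∃ t : ℝ, ¬ HasOnlyRealZeros (deBruijnH t)

/-- Newman's existence of a time with a non-real zero, plus de Bruijn's monotonicity, give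
`Λ > −∞` (`bddBelow_setOf_hasOnlyRealZeros`). [cite: NewmanPAMS1976, Thm. 3] -/
theorem bddBelow_setOf_hasOnlyRealZeros_of_exists_not
    (hex : exists_not_hasOnlyRealZeros_deBruijnH) (hmono : HasOnlyRealZeros.mono_deBruijnH) :
    bddBelow_setOf_hasOnlyRealZeros := by
  obtain ⟨t₀, ht₀⟩ := hex
  exact ⟨t₀, fun t ht ↦ le_of_not_gt fun hlt ↦ ht₀ (hmono hlt.le ht)⟩

/-- Conversely `Λ > −∞` trivially gives a time with a non-real zero. [folklore] -/
theorem exists_not_hasOnlyRealZeros_deBruijnH_of_bddBelow (h : bddBelow_setOf_hasOnlyRealZeros) :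
    exists_not_hasOnlyRealZeros_deBruijnH := by
  obtain ⟨b, hb⟩ := h
  exact ⟨b - 1, fun h1 ↦ by linarith [hb h1]⟩

/-- de Bruijn's strip theorem (`Literature.NumberTheory.LFunctions.de_bruijn_strip`, case `Δ = 0`) gives the monotonicity fact
`HasOnlyRealZeros.mono_deBruijnH`. [cite: Bruijn1950, Thm. 13] -/
theorem mono_deBruijnH_of_strip (hstrip : de_bruijn_strip) : HasOnlyRealZeros.mono_deBruijnH :=
  fun h ht ↦ hstrip.mono ht h

/-- Given `H_0(z) = ξ(½ + iz/2)/8` (`Literature.NumberTheory.LFunctions.deBruijnH_zero_eq`), every zero of `H_0` satisfies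
`|Im z| < 1`, because the zeros of `ξ` lie in the critical strip `0 < Re s < 1`
(`Literature.NumberTheory.LFunctions.riemannXi_eq_zero_iff_holds`). [cite: Titchmarsh1986, §10.1] -/
theorem abs_im_lt_one_of_deBruijnH_zero_eq_zero (h0 : deBruijnH_zero_eq) {z : ℂ}
    (hz : deBruijnH 0 z = 0) : |z.im| < 1 := by
  rw [h0 z, div_eq_zero_iff] at hz
  have hxi : riemannXi (1 / 2 + I * z / 2) = 0 := hz.resolve_right (by norm_num)
  obtain ⟨-, h1, h2⟩ := (riemannXi_eq_zero_iff_holds _).1 hxi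
  have hre : (1 / 2 + I * z / 2 : ℂ).re = 1 / 2 - z.im / 2 := by
    simp [Complex.add_re, Complex.mul_re]
    ring
  rw [hre] at h1 h2
  rw [abs_lt]
  constructor <;> linarith

/-- de Bruijn's bound `Λ ≤ 1/2` (`hasOnlyRealZeros_deBruijnH_one_half`) from the strip theorem
with `Δ = 1` at `t = 0` and `H_0 = ξ(½ + iz/2)/8`. [cite: Bruijn1950, Thm. 13] -/
theorem hasOnlyRealZeros_deBruijnH_one_half_of_strip (hstrip : de_bruijn_strip)
    (h0 : deBruijnH_zero_eq) : hasOnlyRealZeros_deBruijnH_one_half :=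
  hstrip 0 1 zero_le_one (fun _ hz ↦ (abs_im_lt_one_of_deBruijnH_zero_eq_zero h0 hz).le) (1 / 2)
    (by norm_num)

/-- **Newman's characterisation from the printed theorems.** `H_t` has only real zeros iff
`Λ ≤ t`, for every real `t`, assuming exactly: Newman 1976 Thm. 3 (some `H_t` has a non-real
zero: `exists_not_hasOnlyRealZeros_deBruijnH`), de Bruijn 1950 Thm. 13 (`de_bruijn_strip`) and
`H_0 = ξ(½ + iz/2)/8` (`deBruijnH_zero_eq`, Titchmarsh §10.1); closedness (Hurwitz), the critical
strip and all analytic properties of `H_t` are proved in-tree. [cite: NewmanPAMS1976, Thm. 3] -/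
theorem hasOnlyRealZeros_deBruijnH_iff_deBruijnNewmanConst_le_of_newman_of_strip
    (hN : exists_not_hasOnlyRealZeros_deBruijnH) (hstrip : de_bruijn_strip)
    (h0 : deBruijnH_zero_eq) : hasOnlyRealZeros_deBruijnH_iff_deBruijnNewmanConst_le :=
  have hmono : HasOnlyRealZeros.mono_deBruijnH := mono_deBruijnH_of_strip hstrip
  hasOnlyRealZeros_deBruijnH_iff_deBruijnNewmanConst_le_of_bddBelow_of_mono
    (bddBelow_setOf_hasOnlyRealZeros_of_exists_not hN hmono)
    (hasOnlyRealZeros_deBruijnH_one_half_of_strip hstrip h0) hmono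

/-! ## The endpoint `t = 0` (route `RiemannHypothesis/DBN`) -/

/-- **Unconditional.** If `H_t` has only real zeros for every `t > 0`, then so does `H_0`
(closedness of `{t | H_t has only real zeros}`, proved above via Hurwitz). This is the only use of
Newman's theorem in the assembly of the route `RiemannHypothesis/DBN`, and it needs neither
`Λ > −∞` nor de Bruijn's monotonicity. [folklore] -/
theorem hasOnlyRealZeros_deBruijnH_zero_of_forall_pos
    (h : ∀ t : ℝ, 0 < t → HasOnlyRealZeros (deBruijnH t)) : HasOnlyRealZeros (deBruijnH 0) := by
  have hsub : Ioi (0 : ℝ) ⊆ {t : ℝ | HasOnlyRealZeros (deBruijnH t)} := fun t ht ↦ h t ht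
  have h0 : (0 : ℝ) ∈ closure (Ioi (0 : ℝ)) := by rw [closure_Ioi]; exact Set.self_mem_Ici
  exact isClosed_setOf_hasOnlyRealZeros_deBruijnH.closure_subset (closure_mono hsub h0)

/-- `RH ↔ H_0 has only real zeros` (`Literature.NumberTheory.LFunctions.riemannHypothesis_iff_hasOnlyRealZeros_deBruijnH_zero`)
from `H_0 = ξ(½ + iz/2)/8` (`Literature.NumberTheory.LFunctions.deBruijnH_zero_eq`) and Riemann's form of RH
(`Literature.NumberTheory.LFunctions.riemannHypothesis_iff_im_eq_zero_of_riemannXiUpper_eq_zero_holds`, proved in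
`RiemannXiProofs.lean`); this is the interim proof recorded in `DeBruijnNewman.lean`. [cite: Titchmarsh1986, §10.1] -/
theorem riemannHypothesis_iff_hasOnlyRealZeros_deBruijnH_zero_of (h0 : deBruijnH_zero_eq) :
    riemannHypothesis_iff_hasOnlyRealZeros_deBruijnH_zero := by
  unfold riemannHypothesis_iff_hasOnlyRealZeros_deBruijnH_zero
  have hR : RiemannHypothesis ↔ ∀ z : ℂ, riemannXiUpper z = 0 → z.im = 0 :=
    riemannHypothesis_iff_im_eq_zero_of_riemannXiUpper_eq_zero_holds
  rw [hR]
  have key : ∀ z : ℂ, deBruijnH 0 z = riemannXiUpper (z / 2) / 8 := fun z ↦ by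
    rw [h0 z, riemannXiUpper]
    congr 3
    ring
  constructor
  · intro h z hz
    rw [key, div_eq_zero_iff] at hz
    have := h (z / 2) (hz.resolve_right (by norm_num))
    simpa using this
  · intro h z hz
    have := h (2 * z) (by rw [key]; simp [hz])
    simpa using this

/-- The route fact `Literature.NumberTheory.LFunctions.riemannHypothesis_of_hasOnlyRealZeros_deBruijnH` ("real zeros for all
`t > 0` ⇒ RH") from the single named fact `Literature.NumberTheory.LFunctions.deBruijnH_zero_eq`. [cite: NewmanPAMS1976, Thm. 3] -/
theorem riemannHypothesis_of_hasOnlyRealZeros_deBruijnH_of (h0 : deBruijnH_zero_eq) :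
    riemannHypothesis_of_hasOnlyRealZeros_deBruijnH := fun h ↦
  (riemannHypothesis_iff_hasOnlyRealZeros_deBruijnH_zero_of h0).2
    (hasOnlyRealZeros_deBruijnH_zero_of_forall_pos h)

/-! ## rh.S39 — GORZ Theorem 1 -/

/-- **rh.S39**, GORZ Theorem 1 (PNAS 116 (2019), Thm. 1) from the two inputs of its printed proof
(§5.1): positivity of the `γ(n)` (`xiTaylorCoeff_pos`, GORZ §1) and the expansion (15) of §5.1
(`xiTaylorCoeff_logRatio`), via `Literature.NumberTheory.LFunctions.jensenPoly_xiTaylorCoeff_eventually_splits` (GORZ Thm. 3,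
Thm. 6 and Corollary, proved in `JensenHermite.lean`). [cite: GORZPNAS2019, Thm. 1] -/
theorem gorz_eventually_of_logRatio (hpos : xiTaylorCoeff_pos) (h : xiTaylorCoeff_logRatio) :
    gorz_eventually := fun d hd =>
  jensenPoly_xiTaylorCoeff_eventually_splits hpos h d hd

/-- **Discharge of `Literature.NumberTheory.LFunctions.gorz_eventually` — Griffin–Ono–Rolen–Zagier, Theorem 1** (PNAS 116
(2019), Thm. 1): for every `d ≥ 1` the Jensen polynomials `J^{d,n}_γ` of the Taylor coefficients
`γ(n)` of `(-1 + 4z²) Λ(1/2 + z)` are hyperbolic for all sufficiently large `n`. Unconditional: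
both inputs are proved (`xiTaylorCoeff_pos_holds`, `XiMoments.lean`;
`xiTaylorCoeff_logRatio_holds`, `JensenAsymptotics.lean`). [cite: GORZPNAS2019, Thm. 1] -/
theorem gorz_eventually_holds : gorz_eventually :=
  gorz_eventually_of_logRatio xiTaylorCoeff_pos_holds xiTaylorCoeff_logRatio_holds

end Literature.NumberTheory.LFunctions

end
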